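import Summits.CriticalPhenomena.PercolationContinuityZ3.Theorems.PercNearOneGluingNoHeavyLowerTailSahiOneStepFibreDefs
import HarnessLib

/-!
# One-step scheme: the TWO-COPY FIBRE CRITERION for the quantitative-Harris hypothesis `(3′)`

Support file (prover prim-ineq-prove-3 gen 16; `--supports stmt-CriticalPhenomena-4575`; memo
`run/shared/lean/prim/prim-ineq-prove-3/FINDING-G16-FIBRE-MAJ5.md` §2).  No named facts, no sorries, no `native_decide`.

`m′(H;A,B) = osMp p H (ind A) (ind B) = (1+μH)μ(HAB) − μ(H)μ(AB) − μ(HA)μ(HB)`.  Writing each measure of an `F`-determined event as a sum of Bernoulli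
weights over the patterns `S ⊆ F` (`PrW`), `m′` becomes a sum over PAIRS of patterns `(S, S′)` of `wtW S · wtW S′ · φ₂(S,S′)` with the signed indicator
combination `φ₂ = 1_T(S)(1 + 1_H(S′)) − 1_H(S) 1_{AB}(S′) − 1_{HA}(S) 1_{HB}(S′)` (`phi2`).  The pair weight depends on `(S,S′)` only through the FIBRE
`(S ∩ S′, S ∪ S′)` (`wtW_mul_wtW_eq`), so grouping the pairs by fibre (`Finset.sum_fiberwise`) gives the
**two-copy fibre criterion** `osMp_ind_ind_nonneg_of_fibre2`: if for every `I, J ⊆ F` the sum of `φ₂` over the fibre `{(S,S′) : S ∩ S′ = I, S ∪ S′ = J}` is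
`≥ 0`, then `m′ ≥ 0`.  The fibre sums are integers depending only on the traces of `H, A, B` on `J ∖ I` (the coefficients of `m′·Π(1+rᵢ)²` as a polynomial in
the odds `rᵢ = qᵢ/pᵢ`); for a THRESHOLD `H` they are the antipodal counts (3*) of the gen-14 memo, verified `≥ 0` exhaustively for `|J ∖ I| ≤ 5` — the
finite certificates are not part of this file.
-/

noncomputable section

namespace Summit.CriticalPhenomena.PercolationContinuityZ3.Theorems

namespace SahiOneStep

open MeasureTheory Finset
open Literature.Probability.Percolation (DeterminedBy determinedBy_iff determinedBy_univ)
open Literature.Probability.LatticeModels (prodBernoulli)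
open Literature.Probability.Percolation.DecisionTree (ind wtW PrW PrW_eq_sum_ind sum_wtW prodBernoulli_real_eq_PrW)
open scoped Classical

variable {ι : Type*} [Fintype ι] [DecidableEq ι]

omit [Fintype ι] in
/-- The measure of an `F`-determined event as a weighted pattern sum. [folklore] -/
theorem real_eq_sum_wtW_ind (p : ι → unitInterval) {F : Finset ι} {X : Set (Set ι)} (hX : DeterminedBy X (↑F : Set ι)) :
    (prodBernoulli p).real X = ∑ S ∈ F.powerset, wtW F (fun i => (p i : ℝ)) S * ind (pat X) S := by
  rw [prodBernoulli_real_eq_PrW p hX (X := pat X) (fun S _ => Iff.rfl), PrW_eq_sum_ind]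

omit [Fintype ι] in
/-- The pair weight depends only on the fibre `(S ∩ S′, S ∪ S′)`. [folklore] -/
theorem wtW_mul_wtW_eq (F : Finset ι) (p : ι → ℝ) (S S' : Finset ι) :
    wtW F p S * wtW F p S' = wfib F p (S ∩ S') (S ∪ S') := by
  unfold wtW wfib
  rw [← Finset.prod_mul_distrib]
  refine Finset.prod_congr rfl fun i _ => ?_
  by_cases h1 : i ∈ S <;> by_cases h2 : i ∈ S' <;> simp [h1, h2, mul_comm]

/-- **`m′` as a sum over pairs of patterns.** [this work] -/
theorem osMp_ind_ind_eq_sum_pairs (p : ι → unitInterval) {F : Finset ι} {H A B : Set (Set ι)} (hH : DeterminedBy H (↑F : Set ι))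
    (hA : DeterminedBy A (↑F : Set ι)) (hB : DeterminedBy B (↑F : Set ι)) :
    osMp p H (ind A) (ind B) =
      ∑ x ∈ F.powerset ×ˢ F.powerset, wtW F (fun i => (p i : ℝ)) x.1 * wtW F (fun i => (p i : ℝ)) x.2 * phi2 H A B x.1 x.2 := by
  have hHAB : DeterminedBy (H ∩ A ∩ B) (↑F : Set ι) := (hH.inter hA).inter hB
  rw [osMp_ind_ind, real_eq_sum_wtW_ind p hH, real_eq_sum_wtW_ind p hHAB, real_eq_sum_wtW_ind p (hA.inter hB),
    real_eq_sum_wtW_ind p (hH.inter hA), real_eq_sum_wtW_ind p (hH.inter hB)]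
  set pr : ι → ℝ := fun i => (p i : ℝ) with hpr
  have h1 : (1 : ℝ) = ∑ S ∈ F.powerset, wtW F pr S := (sum_wtW F pr).symm
  -- expand every product of sums into a sum over the product finset
  have e1 : (∑ S ∈ F.powerset, wtW F pr S * ind (pat (H ∩ A ∩ B)) S) =
      ∑ x ∈ F.powerset ×ˢ F.powerset, wtW F pr x.1 * wtW F pr x.2 * (ind (pat (H ∩ A ∩ B)) x.1) := by
    conv_lhs => rw [← mul_one (∑ S ∈ F.powerset, wtW F pr S * ind (pat (H ∩ A ∩ B)) S), h1, Finset.sum_mul_sum,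
      ← Finset.sum_product']
    exact Finset.sum_congr rfl fun x _ => by ring
  have e2 : (∑ S ∈ F.powerset, wtW F pr S * ind (pat H) S) * (∑ S ∈ F.powerset, wtW F pr S * ind (pat (H ∩ A ∩ B)) S) =
      ∑ x ∈ F.powerset ×ˢ F.powerset, wtW F pr x.1 * wtW F pr x.2 * (ind (pat (H ∩ A ∩ B)) x.1 * ind (pat H) x.2) := by
    rw [mul_comm, Finset.sum_mul_sum, ← Finset.sum_product']
    exact Finset.sum_congr rfl fun x _ => by ring
  have e3 : (∑ S ∈ F.powerset, wtW F pr S * ind (pat H) S) * (∑ S ∈ F.powerset, wtW F pr S * ind (pat (A ∩ B)) S) =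
      ∑ x ∈ F.powerset ×ˢ F.powerset, wtW F pr x.1 * wtW F pr x.2 * (ind (pat H) x.1 * ind (pat (A ∩ B)) x.2) := by
    rw [Finset.sum_mul_sum, ← Finset.sum_product']
    exact Finset.sum_congr rfl fun x _ => by ring
  have e4 : (∑ S ∈ F.powerset, wtW F pr S * ind (pat (H ∩ A)) S) * (∑ S ∈ F.powerset, wtW F pr S * ind (pat (H ∩ B)) S) =
      ∑ x ∈ F.powerset ×ˢ F.powerset, wtW F pr x.1 * wtW F pr x.2 * (ind (pat (H ∩ A)) x.1 * ind (pat (H ∩ B)) x.2) := by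
    rw [Finset.sum_mul_sum, ← Finset.sum_product']
    exact Finset.sum_congr rfl fun x _ => by ring
  have eL : (1 + ∑ S ∈ F.powerset, wtW F pr S * ind (pat H) S) * (∑ S ∈ F.powerset, wtW F pr S * ind (pat (H ∩ A ∩ B)) S) =
      (∑ S ∈ F.powerset, wtW F pr S * ind (pat (H ∩ A ∩ B)) S) +
        (∑ S ∈ F.powerset, wtW F pr S * ind (pat H) S) * (∑ S ∈ F.powerset, wtW F pr S * ind (pat (H ∩ A ∩ B)) S) := by ring
  rw [eL, e2, e1, e3, e4, ← Finset.sum_add_distrib, ← Finset.sum_sub_distrib, ← Finset.sum_sub_distrib]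
  refine Finset.sum_congr rfl fun x _ => ?_
  unfold phi2
  ring

/-- **TWO-COPY FIBRE CRITERION for `(3′)`.**  If for every fibre `(I, J)` the sum of `φ₂` over the pairs `(S,S′)` of `F`-patterns with `S ∩ S′ = I`,
`S ∪ S′ = J` is nonnegative, then `m′(H;A,B) ≥ 0`. [this work] -/
theorem osMp_ind_ind_nonneg_of_fibre2 (p : ι → unitInterval) {F : Finset ι} {H A B : Set (Set ι)} (hH : DeterminedBy H (↑F : Set ι))
    (hA : DeterminedBy A (↑F : Set ι)) (hB : DeterminedBy B (↑F : Set ι))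
    (hfib : ∀ IJ : Finset ι × Finset ι,
      0 ≤ ∑ x ∈ (F.powerset ×ˢ F.powerset).filter (fun x => (x.1 ∩ x.2, x.1 ∪ x.2) = IJ), phi2 H A B x.1 x.2) :
    0 ≤ osMp p H (ind A) (ind B) := by
  rw [osMp_ind_ind_eq_sum_pairs p hH hA hB]
  set pr : ι → ℝ := fun i => (p i : ℝ) with hpr
  have hp0 : ∀ i, 0 ≤ pr i := fun i => (p i).2.1
  have hp1 : ∀ i, pr i ≤ 1 := fun i => (p i).2.2
  rw [← Finset.sum_fiberwise_of_maps_to (g := fun x : Finset ι × Finset ι => (x.1 ∩ x.2, x.1 ∪ x.2))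
    (t := F.powerset ×ˢ F.powerset) (fun x hx => by
      simp only [Finset.mem_product, Finset.mem_powerset] at hx ⊢
      exact ⟨Finset.inter_subset_left.trans hx.1, Finset.union_subset hx.1 hx.2⟩)]
  refine Finset.sum_nonneg fun IJ _ => ?_
  have hc : ∀ x ∈ (F.powerset ×ˢ F.powerset).filter (fun x => (x.1 ∩ x.2, x.1 ∪ x.2) = IJ),
      wtW F pr x.1 * wtW F pr x.2 * phi2 H A B x.1 x.2 = wfib F pr IJ.1 IJ.2 * phi2 H A B x.1 x.2 := by
    intro x hx
    rw [Finset.mem_filter] at hx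
    rw [wtW_mul_wtW_eq, ← hx.2]
  rw [Finset.sum_congr rfl hc, ← Finset.mul_sum]
  exact mul_nonneg (wfib_nonneg F hp0 hp1 _ _) (hfib IJ)

omit [Fintype ι] in
/-- The triple weight depends only on the fibre key. [folklore] -/
theorem wtW_mul_wtW_mul_wtW_eq (F : Finset ι) (p : ι → ℝ) (x : Finset ι × Finset ι × Finset ι) :
    wtW F p x.1 * wtW F p x.2.1 * wtW F p x.2.2 = wfib3 F p (key3 x).1 (key3 x).2.1 (key3 x).2.2 := by
  unfold wtW wfib3 key3
  rw [← Finset.prod_mul_distrib, ← Finset.prod_mul_distrib]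
  refine Finset.prod_congr rfl fun i _ => ?_
  by_cases h1 : i ∈ x.1 <;> by_cases h2 : i ∈ x.2.1 <;> by_cases h3 : i ∈ x.2.2 <;>
    simp only [Finset.mem_inter, Finset.mem_union, h1, h2, h3, and_true, and_false, or_true,
      or_false, if_true, if_false] <;> ring

/-- **`n` as a sum over triples of patterns.** [this work] -/
theorem osN_ind_ind_eq_sum_triples (p : ι → unitInterval) {F : Finset ι} {H A B : Set (Set ι)} (hH : DeterminedBy H (↑F : Set ι))
    (hA : DeterminedBy A (↑F : Set ι)) (hB : DeterminedBy B (↑F : Set ι)) :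
    osN p H (ind A) (ind B) =
      ∑ x ∈ F.powerset ×ˢ (F.powerset ×ˢ F.powerset),
        wtW F (fun i => (p i : ℝ)) x.1 * wtW F (fun i => (p i : ℝ)) x.2.1 * wtW F (fun i => (p i : ℝ)) x.2.2 * phi3 H A B x.1 x.2.1 x.2.2 := by
  have hHAB : DeterminedBy (H ∩ A ∩ B) (↑F : Set ι) := (hH.inter hA).inter hB
  rw [osN_ind_ind, real_eq_sum_wtW_ind p hH, real_eq_sum_wtW_ind p hHAB, real_eq_sum_wtW_ind p hA, real_eq_sum_wtW_ind p hB,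
    real_eq_sum_wtW_ind p (hH.inter hA), real_eq_sum_wtW_ind p (hH.inter hB)]
  set pr : ι → ℝ := fun i => (p i : ℝ) with hpr
  set P := F.powerset with hP
  -- generic expansion of a product of three weighted sums
  have triple : ∀ f g h : Finset ι → ℝ,
      (∑ S ∈ P, wtW F pr S * f S) * (∑ S ∈ P, wtW F pr S * g S) * (∑ S ∈ P, wtW F pr S * h S) =
        ∑ x ∈ P ×ˢ (P ×ˢ P), wtW F pr x.1 * wtW F pr x.2.1 * wtW F pr x.2.2 * (f x.1 * g x.2.1 * h x.2.2) := by
    intro f g h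
    rw [Finset.sum_mul_sum, Finset.sum_mul]
    simp only [Finset.sum_mul]
    simp only [Finset.mul_sum]
    conv_rhs => rw [Finset.sum_product]; simp only [Finset.sum_product]
    refine Finset.sum_congr rfl fun a _ => Finset.sum_congr rfl fun b _ => Finset.sum_congr rfl fun c _ => ?_
    ring
  have h1 : ∑ S ∈ P, wtW F pr S * (fun _ => (1 : ℝ)) S = 1 := by
    simp only [mul_one]; exact sum_wtW F pr
  -- pad every product to three factors
  have padded :
      (∑ S ∈ P, wtW F pr S * ind (pat (H ∩ A)) S) * (∑ S ∈ P, wtW F pr S * ind (pat (H ∩ B)) S)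
        + (1 - ∑ S ∈ P, wtW F pr S * ind (pat H) S) * (∑ S ∈ P, wtW F pr S * ind (pat (H ∩ A ∩ B)) S)
        + (∑ S ∈ P, wtW F pr S * ind (pat H) S) * (∑ S ∈ P, wtW F pr S * ind (pat A) S) * (∑ S ∈ P, wtW F pr S * ind (pat B) S)
        - (∑ S ∈ P, wtW F pr S * ind (pat (H ∩ A)) S) * (∑ S ∈ P, wtW F pr S * ind (pat B) S)
        - (∑ S ∈ P, wtW F pr S * ind (pat (H ∩ B)) S) * (∑ S ∈ P, wtW F pr S * ind (pat A) S) =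
      (∑ S ∈ P, wtW F pr S * (fun _ => (1 : ℝ)) S) * (∑ S ∈ P, wtW F pr S * ind (pat (H ∩ A)) S) * (∑ S ∈ P, wtW F pr S * ind (pat (H ∩ B)) S)
        + (∑ S ∈ P, wtW F pr S * (fun _ => (1 : ℝ)) S) * (∑ S ∈ P, wtW F pr S * ind (pat (H ∩ A ∩ B)) S) * (∑ S ∈ P, wtW F pr S * (fun _ => (1 : ℝ)) S)
        - (∑ S ∈ P, wtW F pr S * ind (pat H) S) * (∑ S ∈ P, wtW F pr S * ind (pat (H ∩ A ∩ B)) S) * (∑ S ∈ P, wtW F pr S * (fun _ => (1 : ℝ)) S)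
        + (∑ S ∈ P, wtW F pr S * ind (pat H) S) * (∑ S ∈ P, wtW F pr S * ind (pat A) S) * (∑ S ∈ P, wtW F pr S * ind (pat B) S)
        - (∑ S ∈ P, wtW F pr S * (fun _ => (1 : ℝ)) S) * (∑ S ∈ P, wtW F pr S * ind (pat (H ∩ A)) S) * (∑ S ∈ P, wtW F pr S * ind (pat B) S)
        - (∑ S ∈ P, wtW F pr S * (fun _ => (1 : ℝ)) S) * (∑ S ∈ P, wtW F pr S * ind (pat A) S) * (∑ S ∈ P, wtW F pr S * ind (pat (H ∩ B)) S) := by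
    rw [h1]; ring
  rw [padded, triple, triple, triple, triple, triple, triple, ← Finset.sum_add_distrib, ← Finset.sum_sub_distrib, ← Finset.sum_add_distrib,
    ← Finset.sum_sub_distrib, ← Finset.sum_sub_distrib]
  refine Finset.sum_congr rfl fun x _ => ?_
  unfold phi3
  ring

/-- **THREE-COPY FIBRE CRITERION for `(2′)`.**  If for every fibre key `(I₃, I₂, J)` the sum of `φ₃` over the triples of `F`-patterns with that key is
nonnegative, then `n(H;A,B) ≥ 0`. [this work] -/
theorem osN_ind_ind_nonneg_of_fibre3 (p : ι → unitInterval) {F : Finset ι} {H A B : Set (Set ι)} (hH : DeterminedBy H (↑F : Set ι))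
    (hA : DeterminedBy A (↑F : Set ι)) (hB : DeterminedBy B (↑F : Set ι))
    (hfib : ∀ K : Finset ι × Finset ι × Finset ι,
      0 ≤ ∑ x ∈ (F.powerset ×ˢ (F.powerset ×ˢ F.powerset)).filter (fun x => key3 x = K), phi3 H A B x.1 x.2.1 x.2.2) :
    0 ≤ osN p H (ind A) (ind B) := by
  rw [osN_ind_ind_eq_sum_triples p hH hA hB]
  set pr : ι → ℝ := fun i => (p i : ℝ) with hpr
  have hp0 : ∀ i, 0 ≤ pr i := fun i => (p i).2.1
  have hp1 : ∀ i, pr i ≤ 1 := fun i => (p i).2.2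
  rw [← Finset.sum_fiberwise_of_maps_to (g := key3) (t := (F.powerset ×ˢ (F.powerset ×ˢ F.powerset)).image key3)
    (fun x hx => Finset.mem_image_of_mem key3 hx)]
  refine Finset.sum_nonneg fun K _ => ?_
  have hc : ∀ x ∈ (F.powerset ×ˢ (F.powerset ×ˢ F.powerset)).filter (fun x => key3 x = K),
      wtW F pr x.1 * wtW F pr x.2.1 * wtW F pr x.2.2 * phi3 H A B x.1 x.2.1 x.2.2 = wfib3 F pr K.1 K.2.1 K.2.2 * phi3 H A B x.1 x.2.1 x.2.2 := by
    intro x hx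
    rw [Finset.mem_filter] at hx
    rw [wtW_mul_wtW_mul_wtW_eq, hx.2]
  rw [Finset.sum_congr rfl hc, ← Finset.mul_sum]
  exact mul_nonneg (wfib3_nonneg F hp0 hp1 _ _ _) (hfib K)

end SahiOneStep

end Summit.CriticalPhenomena.PercolationContinuityZ3.Theorems
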